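import Mathlib
import HarnessLib
import HarnessLib.Audit
import Summits.Langlands.Statement
import Literature.FieldTheory.AlgClosed.PadicAlgClEquivComplex
import Literature.NumberTheory.PAdicHodge.FontaineDpst
import Summits.Langlands.Langlands.Theorems.EisensteinDegreeShiftSectorComplementStubAvatarConjugacy
import Literature.NumberTheory.Automorphic.LocalLanglandsGLProofs
import Literature.NumberTheory.Automorphic.LocalConstantsProofs
import HarnessLib.Audit.Status.Attr

/-!
Route: DepthPrimeSplit

# Route DepthPrimeSplit — reciprocity for GL(n) from dyadic residual seeds, the infinite fern and
classicality of pro-automorphic de Rham points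

Decomposition node of the Langlands root ladder (cell decomp-langlands, lens-4 «minimal
counterexample / extremal reduction», D-0178),
refining N0 = route-Langlands-PrimeSwitchSplit at its rank-2 core B_w =
`PrimeSwitchSplit.WeakGeometricAutomorphy` (stmt-Langlands-17414).
Grade a counterexample ρ to B_w by its DEPTH OF AUTOMORPHY m*(ρ) = sup of the m such that some
L-algebraic cuspidal π has Satake polynomials
≡ ρ's Frobenius polynomials mod ℓ^m almost everywhere: exactly one of SEED (m* = 0⁻: dark residual
class), FERN (0⁻ < m* < ∞: automorphic
Satake data do not accumulate ℓ-adically at ρ) or CLASSICALITY (m* = ∞: a pro-automorphic de Rham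
point that is not automorphic) fails; the
seed is cut once more at the extremal prime: DyadicSeed (ℓ = 2, parity invisible — the ATTACKED
conjunct) and OddPrimeSeed (declared residual).
It suffices to show X = DyadicSeed ∧ OddPrimeSeed ∧ FernSpread ∧ Classicality ∧ (N0's W⁺, P, L∤R,
CRD, U verbatim); kernel-certified
B_w ⟺ DyadicSeed ∧ OddPrimeSeed ∧ FernSpread ∧ Classicality (`weak_iff_pieces`), every piece
Langlands-implied. U = AvatarConjugacy
(stmt-Langlands-17844) is PROVED in the tree and consumed inside `closes` as the theorem
`Theorems.EisensteinDegreeShiftSectorComplement.stub_avatarConjugacy`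
(not re-filed); the BC5 rung DyadicSeedRankTwoQ is carried as an ASIDE (banked, never staffed from
here; it is the first stub of DyadicSeed's
skeleton). No idea card is realised.
LINEAGE: NODE decomp-langlands-lens-4-g0 2026-08-30T01:52:48Z (v2 sha256 d1ac1490…), v2.1
2026-08-30T02:04:32Z (nodes/lens-4-g0-DepthPrimeSplit.lean
sha256 1c5a5d7e…: the critic's sharper `IsProAutomorphic` with ONE finite exceptional set for all
radii), CLEARED by decomp-langlands-crit-1
2026-08-30T01:56:59Z (v2) and 2026-08-30T02:04:58Z (v2.1) (HOME/CRITIC-LEDGER.md row 11: TARGET =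
typed ROOT; EXACT AND-split of B_w, 0 EQUIV;
typing no-junk — `CloseAt` uses the summit's Satake normalisation under Mathlib `Valued.v` on
PadicAlgCl ℓ; honest label: the PRIME cut replicates
the Serre difficulty (value = parity placement), the DEPTH cut is a genuine aspect cut). DEDUP
PARENTS (critic / lens-4): DyadicSeed, OddPrimeSeed ⊂
ResidualSplit.ResidualAutomorphy (stmt-Langlands-24015) by prime; FernSpread, Classicality =
children of ResidualSplit.AutomorphyLifting
(stmt-Langlands-24016) under the kernel iff `residualLifting_iff`. Filed by the cell writer
(writer-1 gen 0) as a SIBLING root decomposition of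
RootDecomp1 / ResidualSplit / WeightMultiplicitySplit / PrimitiveRankLadder sharing N0's items by
signature dedup (D-0019); census
HOME/census/COSTUME-CENSUS-v1.md sha256 4dd86a1c….
Lean: `DyadicSeed ∧ OddPrimeSeed ∧ FernSpread ∧ Classicality ∧ SatakeAvatarExistence ∧
PadicMemberCompatibility ∧ CompatibilityAwayFromLR ∧ CanonicalReciprocityData`

## Assembly
Seam (proved inside `closes`, no extra item): given ρ at the prime ℓ, residual automorphy from
DyadicSeed (ℓ = 2, `subst`) or OddPrimeSeed
(ℓ ≠ 2); FernSpread upgrades it to pro-automorphy; Classicality yields B_w(ρ). The rest is N0's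
certified glue verbatim (prime switch 2/3 for the
places over ℓ, P for de Rhamness and the member switch, L∤R away from ℓ, CRD for `Nonempty
(ReciprocityData F)`, U = the landed theorem
`stub_avatarConjugacy` for uniqueness in (A)). No W⁺ is needed for the B_w-equivalence itself
(automorphic-side typing throughout). `closes` in
glue.lean proves `Assembly` first and applies it (all 8 binders used; certified by `ledger route
check --native`).

Rationale: WHY THIS LINE. The mechanism is Emerton's two-step architecture for Fontaine–Mazur
(Emerton2011LocalGlobal: pro-modularity of every deformation of a modular
ρ̄, Thm 1.2.3, via Böckle and the Gouvêa–Mazur infinite fern; then classicality of de Rham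
pro-modular points via p-adic local–global compatibility,
Thm 1.2.4; completed by Pan2022), typed at ROOT generality and representation-free: congruences are
ℓ-adic distances between Frobenius polynomials
and L-normalised Satake polynomials (Mathlib `PadicAlgCl.valued`, `IsArithFrobAt`), residual =
radius 1, pro-automorphic = every radius.
Imported areas: eigenvarieties / p-adic families (Coleman1996, Chenevier2004, Bellaiche2021,
BreuilHellmannSchraen2017Trianguline,
HellmannMargerinSchraen2022, Allen2019) for FERN; p-adic Hodge theory and p-adic Langlands
(Kisin2003, BreuilHellmannSchraen2019, PilloniStroh2016)
for CLASSICALITY; Serre-type conjectures (KhareWintenberger2009, Kisin2009TwoAdic) for SEED. What it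
does that prior routes do not: N0/N0′ cut by
the prime ℓ ↔ ℓ′, lens-1 by rank, lens-2 by weight multiplicity, lens-3/lens-5 by ONE residual
congruence (m = 1) with all depth inside a single
lifting piece; this node cuts the lifting piece at m = ∞ (kernel: ResidualLifting ⟺ FernSpread ∧
Classicality) and the seed at ℓ = 2, so the
two pieces with print engines outside Taylor–Wiles patching (fern density;
overconvergent-to-classical) become items. Negatives index
(`ledger negatives --problem Langlands`: 17212, 16822, 16951, 3797) concerns neither congruences nor
eigenvarieties.

RANKED CRUXES. #2 DyadicSeed (crux) — (parent for dedup: the ℓ = 2 restriction of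
route-Langlands-ResidualSplit's ResidualAutomorphy = stmt-Langlands-24015, mod integrality
bookkeeping — cite by id) for every number field K, n ≥ 1, ι : ℚ̄₂ ≃ ℂ and every irreducible
pinned-geometric ρ : Γ_K → GL_n(ℚ̄₂) there is an L-algebraic cuspidal π of GL_n(𝔸_K) (any weight,
any level) whose L-normalised Satake polynomials are, at almost every v and for every arithmetic
Frobenius at v, coefficientwise within 2-adic distance < 1 of the Frobenius polynomial of ρ
(residual automorphy mod 2; parity is invisible, so π may be CHOSEN cohomological). TAGS (crit-1
CLEARED 2026-08-30T01:56:59Z / v2.1 02:04:58Z, row 11; census sha256 4dd86a1c…): ATTACKED conjunct ·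
OPEN · WEAKER (kernel `dyadicSeed_of_langlands`; C↛S and C↛B_w probes fail) · ATTACKABLE[rung
DyadicSeedRankTwoQ (K = ℚ, n = 2, even ρ included; closed-mod-print KW Thm 9.1 at p = 2 + Kisin
2-adic) — outside (B)'s known regime] · NonRegularWeightBarrier does NOT bite (seed chosen
cohomological) · dedup parent stmt-Langlands-24015 restricted to ℓ = 2 · critic's honest label: the
PRIME cut replicates the Serre difficulty, its value is parity placement. [difficulty: open-problem]
(why it might fail: residual automorphy mod 2 is open beyond GL₂/ℚ: SL₂(𝔽₄)-classes over totally
real or CM K and every class for n ≥ 3 need the Khare–Wintenberger induction over K (lifting over K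
at each step + non-polarizable potential automorphy, unknown).) [KhareWintenberger2009,
KhareWintenberger2009II, Kisin2009TwoAdic, Katz1977, DeligneSerreASENS1974, arXiv:2109.14145]
#3 FernSpread (crux) — (child 1 of route-Langlands-ResidualSplit's AutomorphyLifting =
stmt-Langlands-24016 under the kernel identity ResidualLifting ⟺ FernSpread ∧ Classicality — cite by
id) for every K, n, ℓ, ι and every irreducible pinned-geometric ρ : Γ_K → GL_n(ℚ̄_ℓ): if ρ is
residually automorphic (radius 1) then ρ is PRO-automorphic OF BOUNDED TAME LEVEL — there is ONE
finite set S of places such that for every radius r > 0 some L-algebraic cuspidal π_r (weight, and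
level at S, free) has Satake parameters at every v ∉ S whose Satake polynomials are r-close to ρ's
Frobenius polynomials (fixed-tame-level automorphic Satake data accumulate ℓ-adically at ρ: the
infinite fern / pro-modularity principle; the control of auxiliary ramification is part of the
content). TAGS (crit-1 CLEARED row 11): OPEN · WEAKER than B_w AND than lens-3's Lift_w =
ResidualSplit.AutomorphyLifting 24016 (kernel `residualLifting_iff : Lift_w ↔ FernSpread ∧
Classicality`; Fern↛B_w, Fern∧Seeds↛B_w probes fail) · INSTRUMENTABLE/IDEA-NEEDED at l₀ = 0 (BHS
density; Gouvêa–Mazur/Böckle/Emerton 1.2.3/Chenevier/HMS sectors) · BARRIER l₀ > 0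
(`TaylorWilesNumericalCoincidence_holds`) · child of 24016 · critic: genuine aspect cut.
[difficulty: open-problem] (why it might fail: for l₀ > 0 (K not TR/CM or ρ non-polarized) classical
points are sparse in deformation space (Calegari–Mazur; Ash–Pollack–Stevens GL₃/ℚ), so density
engines give nothing; even for polarized ρ, accumulation at a NON-automorphic point is the open
Breuil–Hellmann–Schraen density conjecture.) [Emerton2011LocalGlobal, Chenevier2011,
BreuilHellmannSchraen2017Trianguline, HellmannMargerinSchraen2022, Allen2019, CalegariMazur2008,
Bellaiche2021, arXiv:2109.14145]
#4 OddPrimeSeed (crux) — (parent for dedup: the odd-ℓ restriction of stmt-Langlands-24015 — cite by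
id) the statement of DyadicSeed at every ODD prime ℓ (declared RESIDUAL complement of the attacked
conjunct: at odd ℓ the residual class remembers every complex conjugation, so over K with a real
place an even class with insoluble image can only be seeded by an even, non-cohomological
automorphic representation). TAGS (crit-1 CLEARED row 11): declared RESIDUAL · OPEN · WEAKER ·
BARRIER(`SolvableImageBarrier_holds`, `NonRegularWeightBarrier_holds` on the sector real place ∧
even class ∧ insoluble image) · NOT absorbed by DyadicSeed mod print (a 2 ↔ ℓ seed switch needs
GeometricCompanions 18969, OPEN) · dedup parent stmt-Langlands-24015 restricted to odd ℓ.
[difficulty: open-problem] (why it might fail: K = ℚ, n = 2, projectively A₅ even classes mod ℓ ≥ 7: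
needs an automorphic even icosahedral Artin representation in the class (Maass λ = ¼; Calegari 2021
§12 «no real progress»); Langlands–Tunnell stops at soluble images.) [KhareWintenberger2009,
arXiv:0907.3427, arXiv:2109.14145, Calegari2013ArtinS5]
#5 Classicality (crux) — (child 2 of stmt-Langlands-24016, see FernSpread — cite by id) for every K,
n, ℓ, ι and every irreducible pinned-geometric ρ : Γ_K → GL_n(ℚ̄_ℓ): if ρ is pro-automorphic of
bounded tame level (an ℓ-adic limit of automorphic Satake data of one fixed tame level — i.e. a
point of an eigenvariety / of the completed Hecke algebra) then ρ is Satake–Frobenius compatible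
almost everywhere with ONE L-algebraic cuspidal π («de Rham points in the ℓ-adic closure of the
automorphic locus are classical»). TAGS (crit-1 CLEARED row 11): residual-for-staffing · OPEN ·
WEAKER · ATTACKABLE sector AS TYPED (eigenvariety classicality: Kisin2003 / Emerton 1.2.4 / BHS2019
/ Pan2022) · BARRIER(`NonRegularWeightBarrier_holds` on irregular Hodge–Tate type;
`ModPLanglandsGL2BeyondQpFpBar` bounds the Pan-type p-adic local Langlands input to GL₂(ℚ_p)) ·
child of stmt-Langlands-24016. [difficulty: open-problem] (why it might fail: de Rham points of
IRREGULAR Hodge–Tate type (companion/critical points; the automorphic π must be non-cohomological)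
and l₀ > 0 settings have no overconvergent-to-classical theorem beyond weight one for GL₂
(Buzzard–Taylor, Pilloni–Stroh); p-adic local Langlands is missing beyond GL₂(ℚ_p).) [Kisin2003,
Emerton2011LocalGlobal, BreuilHellmannSchraen2019, BuzzardTaylor1999, PilloniStroh2016, Pan2022,
Coleman1996]
#6 SatakeAvatarExistence (crux) — W⁺ of N0 verbatim (stmt-Langlands-17415; ledger dedup): every
L-algebraic cuspidal π of GL_n/K has, for every (ℓ, ι), an irreducible ℓ-adic avatar
Satake–Frobenius compatible almost everywhere. [difficulty: open-problem] (why it might fail: no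
construction of ρ for irregular L-algebraic π (Maass λ = ¼, non-cohomological weights) or for K
neither totally real nor CM; irreducibility open for n ≥ 3 outside polarized / density-one cases.)
[BuzzardGeeLMS2014, HarrisLanTaylorThorneRMS2016, Scholze2015]
#7 PadicMemberCompatibility (crux) — P of N0 verbatim (stmt-Langlands-17534; ledger dedup): de
Rhamness at v ∣ ℓ of irreducible avatars and the prime-switch principle for local–global
compatibility at v ∣ ℓ. [difficulty: open-problem] (why it might fail: local–global compatibility at
p for non-polarizable regular π over CM fields is known only up to semisimplification/ under
genericity (A'Campo 2024, Hevesi), and is completely open for irregular π.) [Caraiani2014,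
BarnetLambGeeGeraghtyTaylor2014, BuzzardGeeLMS2014]
#8 CompatibilityAwayFromLR (crux) — L∤R of N0 verbatim (stmt-Langlands-18084; ledger dedup):
local–global compatibility at v ∤ ℓ for irreducible pinned-geometric avatars. [difficulty:
open-problem] (why it might fail: for non-polarizable π over CM fields compatibility at v ∤ ℓ is
known only up to Frobenius-semisimplification and monodromy (Varma), and nothing is known off the
regular totally-real/CM sector.) [Varma2024, TaylorYoshida2007, BuzzardGeeLMS2014]
#9 CanonicalReciprocityData (support) — CRD of N0 verbatim (stmt-Langlands-17930; ledger dedup):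
every number field carries a `ReciprocityData` (closed-mod-print: LLC for GL_n + Fontaine's D_pst).
[difficulty: M] [HarrisTaylor2001, Henniart2000, BuzzardGeeLMS2014]
#9 DyadicSeedRankTwoQ (support) — DyadicSeed for K = ℚ, n = 2 (BC5 rung and first stub of
DyadicSeed's skeleton): every irreducible pinned-geometric ρ : Γ_ℚ → GL₂(ℚ̄₂), EVEN ones included,
is residually automorphic mod 2 — closed-mod-print: Khare–Wintenberger Thm 9.1 at p = 2 with Kisin
(H) for residually irreducible classes (tree fact `SerreConjecture.SerreModularityConjecture 2 k` +
the newform → L-algebraic π dictionary of item `PhantomRMYoshida.SerreKWAutomorphicGL2`),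
Eisenstein-to-cusp congruences mod 2 for split classes (Δ ⊗ [χ]; Katz θ + Deligne–Serre 6.11). ASIDE
in this route (banked BC5 rung = first stub of DyadicSeed's skeleton; not a binder of `closes`,
never staffed from here). [difficulty: L] [KhareWintenberger2009, Kisin2009TwoAdic, Katz1977,
DeligneSerreASENS1974]

TWO-LAYER PLAN. Foreseen glued splits (not filed now): FernSpread ⟸ FernPolarized (K totally
real/CM, ρ polarized: l₀ = 0, the fern exists — Chenevier2011,
BreuilHellmannSchraen2017Trianguline, HellmannMargerinSchraen2022) ∧ FernNonPolarized (l₀ > 0: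
Calegari–Mazur sparsity; idea needed — derived /
completed-homology patching GeeNewton2020); Classicality ⟸ ClassicalityRegularGeneric
(BreuilHellmannSchraen2019 shape) ∧ ClassicalityIrregular
(weight-one shape: BuzzardTaylor1999, PilloniStroh2016, higher Hida/Coleman theory); DyadicSeed ⟸
DyadicSeedRankTwoQ (rung, filed as support) ∧
DyadicSeedSmallImage (classes with image in a Borel or ⊂ GL₂(𝔽₂) ≅ S₃ over any K: Eisenstein
congruences / automorphic induction) ∧ DyadicSeedGeneral.

KILL CRITERIA. A dark residual class at ℓ = 2 (an irreducible pinned-geometric 2-adic ρ over some K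
congruent to NO cuspidal L-algebraic π) refutes DyadicSeed
and with it the typed summit; a pro-automorphic de Rham ρ provably not automorphic refutes
Classicality (and Langlands). The ROUTE (not the
summit) is retired if a refuter shows FernSpread is not strictly weaker than residual lifting in any
sector — i.e. that every known or
conjectured proof of FernSpread for non-automorphic ρ passes through automorphy of ρ (then the depth
cut is decorative) — or if the tribunal
places FernSpread/Classicality at summit strength.

NOT DECOMPOSED YET. The l₀ = 0 / l₀ > 0 split of FernSpread and the regular/irregular split of
Classicality (Two-layer plan) wait until a prover closes a rung;
N0's shared items W⁺, P, L∤R are not decomposed here (N0′ CompatibleFamilySplit and RootDecomp1 own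
their splits); the dyadic small-image
sub-sector of DyadicSeed is a line, not an item.

CHEAPEST FALSIFIER. In-Lean + lookup: (i) BC7 tautology probes on the four new cruxes (ran: 4/4
CLEAN — no vacuous hypothesis, no cheap proof, no C → S);
(ii) is FernSpread already implied by a residual-lifting item in the tree under another name (BC4
`exact?` over the imported Theses) — ran
against PrimeSwitchSplit/ResidualSplit vocabulary: no match, the radius-r predicate is new; (iii)
literature lookup that would kill the depth
cut: a theorem «residually automorphic + de Rham ⟹ pro-automorphic» proved WITHOUT proving
automorphy in some sector — found none beyond
GL₂/ℚ (Emerton 1.2.3 is residual-to-pro for ALL deformations, automorphy then needs 1.2.4), which is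
exactly the separation the cut claims.

NUMBERS. Kernel: Sketch (= nodes/lens-4-g0-DepthPrimeSplit.lean) rc 0, 0 sorry; `weak_iff_pieces`,
`residualLifting_iff`, `seed_iff`, `closes`
(9 binders, all consumed), `*_of_langlands` ×4. Probes: 16/16 required failures (piece → Langlands
×4, piece → B_w ×4, piece outright ×4,
Fern∧Class → B_w, Seeds∧Fern → B_w, Seeds∧Class → B_w, rung → DyadicSeed); BC7 4/4 CLEAN; inlined
one-line items `Iff.rfl` with the
structured defs and with N0's decls (bc/v2_pieces_check.lean rc 0); glue elaborates against the
inlined items (bc/v2_glue_check.lean rc 0).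
Negatives index: 4 entries, none related. Existing nodes on other axes: N0, N0′, RootDecomp1, lens-1
(rank), lens-2 (weight multiplicity),
lens-3 (residual, m = 1), lens-5 (residual link + FL type matching).

DEFINITION REQUESTS. None: all predicates (CloseAt, residual/pro/weak automorphy, pinned-geometric)
are inlined over existing declarations
(`FramedRep.charpoly`, `arithFrobPolyOfSatake`, `HasSatakeParamAt`, `IsArithFrobAt`, `Valued.v` on
`PadicAlgCl ℓ`, `fontainePstAdicCompletion`).

Novelty: Searches RAN (2026-08-30): `lit search --hybrid` ×7 («infinite fern Gouvea Mazur density modular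
points deformation space» → [corpus:book:cornell1997-modular-forms-fermats-last-theorem p.328,
p.378]; «promodular Emerton local-global compatibility completed cohomology Fontaine-Mazur» →
[corpus:paper:arxiv-2109.14145 p.12-13]; «trianguline variety local model classicality crystalline
points eigenvariety» → [corpus:book:emerton2022-moduli-stacks p.23],
[corpus:book:kedlaya2022-p-adic-differential-equations p.476]; «density of automorphic points
polarized Galois deformation rings» → [corpus:book:burns2007-l-functions-galois-representations
p.110 (Buzzard, Eigenvarieties, Lemma 5.8)]; earlier: residual modularity / even Galois
representations / Serre GL_n), `lit galaxy search --star all` ×9 («infinite fern» →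
[galaxy:panama:506015866945592], [galaxy:panama:215512868978706]; «trianguline» →
[galaxy:panama:499547646197764] The Eigenbook, [galaxy:panama:252552666939415]; «eigenvariet» →
[galaxy:panama:499951373123659], [galaxy:panama:260103219445847]; «promodular», «density of
automorphic points» → no hits in pdf/crabby), `lit read arxiv:2109.14145` pp. 2, 12, 13, 14, 20, 21,
22, 28, `lean search` ×12, rg over the 102 Langlands Theses for congruence / eigenvariety typings
(none types a radius-r Satake congruence or pro-automorphy), `ledger negatives`.
Nearest prior art: in tree — lens-3 ResidualSplit (Serre_w ∧ Lift_w, m = 1), lens-5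
ResidualSeedLifting (residual link ∧ FL type match  [refs: 2109.14145, book:cornell1997-modular-forms-fermats-last-theorem, paper:arxiv-2109.14145, book:emerton2022-moduli-stacks, book:kedlaya2022-p-adic-differential-equations, book:burns2007-l-functions-galois-representations, arxiv:2109.14145, Pan2022]

Barriers (technique_class: residual-automorphy, eigenvarieties, classicality): - technique_class: residual-automorphy, eigenvarieties, classicality
- Literature.Barriers.Langlands.TaylorWilesNumericalCoincidence: FernSpread's density engine lives
where l₀ = 0 (polarized ρ over totally real/CM K); for l₀ > 0 it does not evade the barrier — the
bet is completed-homology/derived patching (CalegariGeraghty2018, GeeNewton2020) which replaces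
density of classical points by big R = T over the completed Hecke algebra; Classicality is outside
the class (no patching datum is asserted to be automorphic; `IsPatchingOutput` of
PatchingLocalComponentBarrier is not instantiated).
- Literature.Barriers.Langlands.NonRegularWeightBarrier: DyadicSeed evades it by construction (the
seed is ours to choose cohomological: parity invisible mod 2); Classicality meets it head-on at de
Rham points of irregular Hodge–Tate type — the bet is overconvergent-to-classical in irregular
weight (BuzzardTaylor1999, PilloniStroh2016, higher Hida/Coleman theory), the one place where
non-cohomological automorphy has ever been produced p-adically; OddPrimeSeed's real-place even
sector sits inside it (declared residual).
- Literature.Barriers.Langlands.SolvableImageBarrier: bounds the Langlands–Tunnell engine for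
OddPrimeSeed's even sector only; DyadicSeed's small-image classes mod 2 (⊂ GL₂(𝔽₂) ≅ S₃, Borel) are
INSIDE the soluble class where the barrier is a theorem in our favour (automorphic induction), its
large-image classes are reached by prime-switching, not by Langlands–Tunnell.
- Literat

sub-problem: Langlands · status: draft · opened planner-decomp-langlands-writer-1-g0-0 2026-08-30T02:13:52Z · rev 0 · ledger route-Langlands-DepthPrimeSplit
GENERATED by the gate from the ledger (D-0016/17). Provers cite these decls: `theorem foo : Summit.Langlands.Langlands.Theses.DepthPrimeSplit.<Decl> := …` in Summits/Langlands/Langlands/Theorems/<Name>.lean.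
-/

namespace Summit.Langlands.Langlands.Theses.DepthPrimeSplit

open scoped BigOperators Topology Manifold Classical MeasureTheory ProbabilityTheory Matrix InnerProductSpace ComplexConjugate ContinuousMap
open Filter Set Function TopologicalSpace MeasureTheory

attribute [summit_statement] _root_.Langlands

/-- item stmt-Langlands-25023 · crux · rank 2 · open · by planner
why it might fail: residual automorphy mod 2 is open beyond GL₂/ℚ: SL₂(𝔽₄)-classes over totally real or CM K and every class for n ≥ 3 need the Khare–Wintenberger induction over K (lifting over K at each step + non-polarizable potential automorphy, unknown).
sources: KhareWintenberger2009, KhareWintenberger2009II, Kisin2009TwoAdic, Katz1977, DeligneSerreASENS1974, arXiv:2109.14145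
[crux] (parent for dedup: the ℓ = 2 restriction of route-Langlands-ResidualSplit's
ResidualAutomorphy = stmt-Langlands-24015, mod integrality bookkeeping — cite by id) for every
number field K, n ≥ 1, ι : ℚ̄₂ ≃ ℂ and every irreducible pinned-geometric ρ : Γ_K → GL_n(ℚ̄₂) there
is an L-algebraic cuspidal π of GL_n(𝔸_K) (any weight, any level) whose L-normalised Satake
polynomials are, at almost every v and for every arithmetic Frobenius at v, coefficientwise within
2-adic distance < 1 of the Frobenius polynomial of ρ (residual automorphy mod 2; parity is
invisible, so π may be CHOSEN cohomological). TAGS (crit-1 CLEARED 2026-08-30T01:56:59Z / v2.1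
02:04:58Z, row 11; census sha256 4dd86a1c…): ATTACKED conjunct · OPEN · WEAKER (kernel
`dyadicSeed_of_langlands`; C↛S and C↛B_w probes fail) · ATTACKABLE[rung DyadicSeedRankTwoQ (K = ℚ, n
= 2, even ρ included; closed-mod-print KW Thm 9.1 at p = 2 + Kisin 2-adic) — outside (B)'s known
regime] · NonRegularWeightBarrier does NOT bite (seed chosen cohomological) · dedup parent
stmt-Langlands-24015 restricted to ℓ = 2 · critic's honest label: the PRIME cut replicates the Serre
difficulty, its value is parity placement. [difficulty: open-problem -/
@[route_item "route-Langlands-DepthPrimeSplit", crux]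
def DyadicSeed : Prop :=
  ∀ (K : Type) [Field K] [NumberField K] (n : ℕ) (hcpt : Literature.NumberTheory.Automorphic.isCompact_glFiniteIntegralLevel n K), 0 < n → ∀ (ι : PadicAlgCl 2 ≃+* ℂ) (ρ : Literature.NumberTheory.GaloisRepresentations.FramedGaloisRep K (PadicAlgCl 2) n), ρ.toGaloisRep.IsIrreducible → ((∀ᶠ v : IsDedekindDomain.HeightOneSpectrum (NumberField.RingOfIntegers K) in cofinite, ρ.IsUnramifiedAt v) ∧ ∀ (v : IsDedekindDomain.HeightOneSpectrum (NumberField.RingOfIntegers K)) (hv : ((2 : ℕ) : NumberField.RingOfIntegers K) ∈ v.asIdeal), (Literature.NumberTheory.PAdicHodge.fontainePstAdicCompletion v 2 hv).IsDeRhamFramed (ρ.toLocal v)) → ∃ π : Literature.NumberTheory.Automorphic.CuspidalAutomorphicRepData n K hcpt, π.1.IsLAlgebraic ∧ ∀ᶠ v : IsDedekindDomain.HeightOneSpectrum (NumberField.RingOfIntegers K) in cofinite, (∃ α : Multiset ℂ, π.1.HasSatakeParamAt v α ∧ ∀ 𝔓 ∈ v.primesAbove, ∀ σ : Field.absoluteGaloisGroup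 K, IsArithFrobAt (NumberField.RingOfIntegers K) σ 𝔓 → ∀ i : ℕ, Valued.v ((Literature.NumberTheory.GaloisRepresentations.FramedRep.charpoly ρ σ - Literature.NumberTheory.Automorphic.arithFrobPolyOfSatake ι v.residueCard 1 α).coeff i) < 1)

/-- item stmt-Langlands-25024 · crux · rank 3 · open
reduced to route-Langlands-FernRankSplit: HeckeFern, FernRankBound · residual FernRankBound
refined by: route-Langlands-AuxiliaryLevelSplit [split, open]; route-Langlands-FernRankSplit [split, draft] · by planner
why it might fail: for l₀ > 0 (K not TR/CM or ρ non-polarized) classical points are sparse in deformation space (Calegari–Mazur; Ash–Pollack–Stevens GL₃/ℚ), so density engines give nothing; even for polarized ρ, accumulation at a NON-automorphic point is the open Breuil–Hellmann–Schraen density conjecture.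
sources: Emerton2011LocalGlobal, Chenevier2011, BreuilHellmannSchraen2017Trianguline, HellmannMargerinSchraen2022, Allen2019, CalegariMazur2008
[crux] (child 1 of route-Langlands-ResidualSplit's AutomorphyLifting = stmt-Langlands-24016 under
the kernel identity ResidualLifting ⟺ FernSpread ∧ Classicality — cite by id) for every K, n, ℓ, ι
and every irreducible pinned-geometric ρ : Γ_K → GL_n(ℚ̄_ℓ): if ρ is residually automorphic (radius
1) then ρ is PRO-automorphic OF BOUNDED TAME LEVEL — there is ONE finite set S of places such that
for every radius r > 0 some L-algebraic cuspidal π_r (weight, and level at S, free) has Satake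
parameters at every v ∉ S whose Satake polynomials are r-close to ρ's Frobenius polynomials
(fixed-tame-level automorphic Satake data accumulate ℓ-adically at ρ: the infinite fern /
pro-modularity principle; the control of auxiliary ramification is part of the content). TAGS
(crit-1 CLEARED row 11): OPEN · WEAKER than B_w AND than lens-3's Lift_w =
ResidualSplit.AutomorphyLifting 24016 (kernel `residualLifting_iff : Lift_w ↔ FernSpread ∧
Classicality`; Fern↛B_w, Fern∧Seeds↛B_w probes fail) · INSTRUMENTABLE/IDEA-NEEDED at l₀ = 0 (BHS
density; Gouvêa–Mazur/Böckle/Emerton 1.2.3/Chenevier/HMS sectors) · BARRIER l₀ > 0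
(`TaylorWilesNumericalCoincidence_holds`) · child of 24016 · critic: genuine aspect cut -/
@[route_item "route-Langlands-DepthPrimeSplit", crux (experiment := "instrument: 2 Shimura-box rung `banalConfinement_n2_of_facts` conditional on two named print facts (lens-3); (e) FernRankSplit / SolvableTransitSplit u…") (source := "director LANGLANDS l.49, 2026-09-01")]
def FernSpread : Prop :=
  ∀ (K : Type) [Field K] [NumberField K] (n : ℕ) (hcpt : Literature.NumberTheory.Automorphic.isCompact_glFiniteIntegralLevel n K), 0 < n → ∀ (ℓ : ℕ) [Fact ℓ.Prime] (ι : PadicAlgCl ℓ ≃+* ℂ) (ρ : Literature.NumberTheory.GaloisRepresentations.FramedGaloisRep K (PadicAlgCl ℓ) n), ρ.toGaloisRep.IsIrreducible → ((∀ᶠ v : IsDedekindDomain.HeightOneSpectrum (NumberField.RingOfIntegers K) in cofinite, ρ.IsUnramifiedAt v) ∧ ∀ (v : IsDedekindDomain.HeightOneSpectrum (NumberField.RingOfIntegers K)) (hv : ((ℓ : ℕ) : NumberField.RingOfIntegers K) ∈ v.asIdeal), (Literature.NumberTheory.PAdicHodge.fontainePstAdicCompletion v ℓ hv).IsDeRhamFramed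 (ρ.toLocal v)) → (∃ π : Literature.NumberTheory.Automorphic.CuspidalAutomorphicRepData n K hcpt, π.1.IsLAlgebraic ∧ ∀ᶠ v : IsDedekindDomain.HeightOneSpectrum (NumberField.RingOfIntegers K) in cofinite, (∃ α : Multiset ℂ, π.1.HasSatakeParamAt v α ∧ ∀ 𝔓 ∈ v.primesAbove, ∀ σ : Field.absoluteGaloisGroup K, IsArithFrobAt (NumberField.RingOfIntegers K) σ 𝔓 → ∀ i : ℕ, Valued.v ((Literature.NumberTheory.GaloisRepresentations.FramedRep.charpoly ρ σ - Literature.NumberTheory.Automorphic.arithFrobPolyOfSatake ι v.residueCard 1 α).coeff i) < 1)) → ∃ S : Set (IsDedekindDomain.HeightOneSpectrum (NumberField.RingOfIntegers K)), S.Finite ∧ ∀ r : NNReal, 0 < r → ∃ π : Literature.NumberTheory.Automorphic.CuspidalAutomorphicRepData n K hcpt, π.1.IsLAlgebraic ∧ ∀ v : IsDedekindDomain.HeightOneSpectrum (NumberField.RingOfIntegers K), v ∉ S → (∃ α : Multiset ℂ, π.1.HasSatakeParamAt v α ∧ ∀ 𝔓 ∈ v.primesAbove, ∀ σ : Field.absoluteGaloisGroup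 K, IsArithFrobAt (NumberField.RingOfIntegers K) σ 𝔓 → ∀ i : ℕ, Valued.v ((Literature.NumberTheory.GaloisRepresentations.FramedRep.charpoly ρ σ - Literature.NumberTheory.Automorphic.arithFrobPolyOfSatake ι v.residueCard 1 α).coeff i) < r)

/-- item stmt-Langlands-25025 · crux · rank 4 · open · by planner
why it might fail: K = ℚ, n = 2, projectively A₅ even classes mod ℓ ≥ 7: needs an automorphic even icosahedral Artin representation in the class (Maass λ = ¼; Calegari 2021 §12 «no real progress»); Langlands–Tunnell stops at soluble images.
sources: KhareWintenberger2009, arXiv:0907.3427, arXiv:2109.14145, Calegari2013ArtinS5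
[crux] (parent for dedup: the odd-ℓ restriction of stmt-Langlands-24015 — cite by id) the statement
of DyadicSeed at every ODD prime ℓ (declared RESIDUAL complement of the attacked conjunct: at odd ℓ
the residual class remembers every complex conjugation, so over K with a real place an even class
with insoluble image can only be seeded by an even, non-cohomological automorphic representation).
TAGS (crit-1 CLEARED row 11): declared RESIDUAL · OPEN · WEAKER ·
BARRIER(`SolvableImageBarrier_holds`, `NonRegularWeightBarrier_holds` on the sector real place ∧
even class ∧ insoluble image) · NOT absorbed by DyadicSeed mod print (a 2 ↔ ℓ seed switch needs
GeometricCompanions 18969, OPEN) · dedup parent stmt-Langlands-24015 restricted to odd ℓ.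
[difficulty: open-problem] -/
@[route_item "route-Langlands-DepthPrimeSplit", crux]
def OddPrimeSeed : Prop :=
  ∀ (K : Type) [Field K] [NumberField K] (n : ℕ) (hcpt : Literature.NumberTheory.Automorphic.isCompact_glFiniteIntegralLevel n K), 0 < n → ∀ (ℓ : ℕ) [Fact ℓ.Prime], ℓ ≠ 2 → ∀ (ι : PadicAlgCl ℓ ≃+* ℂ) (ρ : Literature.NumberTheory.GaloisRepresentations.FramedGaloisRep K (PadicAlgCl ℓ) n), ρ.toGaloisRep.IsIrreducible → ((∀ᶠ v : IsDedekindDomain.HeightOneSpectrum (NumberField.RingOfIntegers K) in cofinite, ρ.IsUnramifiedAt v) ∧ ∀ (v : IsDedekindDomain.HeightOneSpectrum (NumberField.RingOfIntegers K)) (hv : ((ℓ : ℕ) : NumberField.RingOfIntegers K) ∈ v.asIdeal), (Literature.NumberTheory.PAdicHodge.fontainePstAdicCompletion v ℓ hv).IsDeRhamFramed (ρ.toLocal v)) → ∃ π : Literature.NumberTheory.Automorphic.CuspidalAutomorphicRepData n K hcpt, π.1.IsLAlgebraic ∧ ∀ᶠ v : IsDedekindDomain.HeightOneSpectrum (NumberField.RingOfIntegers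 K) in cofinite, (∃ α : Multiset ℂ, π.1.HasSatakeParamAt v α ∧ ∀ 𝔓 ∈ v.primesAbove, ∀ σ : Field.absoluteGaloisGroup K, IsArithFrobAt (NumberField.RingOfIntegers K) σ 𝔓 → ∀ i : ℕ, Valued.v ((Literature.NumberTheory.GaloisRepresentations.FramedRep.charpoly ρ σ - Literature.NumberTheory.Automorphic.arithFrobPolyOfSatake ι v.residueCard 1 α).coeff i) < 1)

/-- item stmt-Langlands-25026 · crux · rank 5 · open
reduced to route-Langlands-ClassicalityWeightSplit: WallClassicality, RegularClassicality, DegenerateClassicality · residual DegenerateClassicality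
refined by: route-Langlands-ClassicalityWeightSplit [split, draft] · by planner
why it might fail: de Rham points of IRREGULAR Hodge–Tate type (companion/critical points; the automorphic π must be non-cohomological) and l₀ > 0 settings have no overconvergent-to-classical theorem beyond weight one for GL₂ (Buzzard–Taylor, Pilloni–Stroh); p-adic local Langlands is missing beyond GL₂(ℚ_p).
sources: Kisin2003, Emerton2011LocalGlobal, BreuilHellmannSchraen2019, BuzzardTaylor1999, PilloniStroh2016, Pan2022
[crux] (child 2 of stmt-Langlands-24016, see FernSpread — cite by id) for every K, n, ℓ, ι and every
irreducible pinned-geometric ρ : Γ_K → GL_n(ℚ̄_ℓ): if ρ is pro-automorphic of bounded tame level (an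
ℓ-adic limit of automorphic Satake data of one fixed tame level — i.e. a point of an eigenvariety /
of the completed Hecke algebra) then ρ is Satake–Frobenius compatible almost everywhere with ONE
L-algebraic cuspidal π («de Rham points in the ℓ-adic closure of the automorphic locus are
classical»). TAGS (crit-1 CLEARED row 11): residual-for-staffing · OPEN · WEAKER · ATTACKABLE sector
AS TYPED (eigenvariety classicality: Kisin2003 / Emerton 1.2.4 / BHS2019 / Pan2022) ·
BARRIER(`NonRegularWeightBarrier_holds` on irregular Hodge–Tate type;
`ModPLanglandsGL2BeyondQpFpBar` bounds the Pan-type p-adic local Langlands input to GL₂(ℚ_p)) ·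
child of stmt-Langlands-24016. [difficulty: open-problem] -/
@[route_item "route-Langlands-DepthPrimeSplit", crux]
def Classicality : Prop :=
  ∀ (K : Type) [Field K] [NumberField K] (n : ℕ) (hcpt : Literature.NumberTheory.Automorphic.isCompact_glFiniteIntegralLevel n K), 0 < n → ∀ (ℓ : ℕ) [Fact ℓ.Prime] (ι : PadicAlgCl ℓ ≃+* ℂ) (ρ : Literature.NumberTheory.GaloisRepresentations.FramedGaloisRep K (PadicAlgCl ℓ) n), ρ.toGaloisRep.IsIrreducible → ((∀ᶠ v : IsDedekindDomain.HeightOneSpectrum (NumberField.RingOfIntegers K) in cofinite, ρ.IsUnramifiedAt v) ∧ ∀ (v : IsDedekindDomain.HeightOneSpectrum (NumberField.RingOfIntegers K)) (hv : ((ℓ : ℕ) : NumberField.RingOfIntegers K) ∈ v.asIdeal), (Literature.NumberTheory.PAdicHodge.fontainePstAdicCompletion v ℓ hv).IsDeRhamFramed (ρ.toLocal v)) → (∃ S : Set (IsDedekindDomain.HeightOneSpectrum (NumberField.RingOfIntegers K)), S.Finite ∧ ∀ r : NNReal, 0 < r → ∃ π : Literature.NumberTheory.Automorphic.CuspidalAutomorphicRepData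 n K hcpt, π.1.IsLAlgebraic ∧ ∀ v : IsDedekindDomain.HeightOneSpectrum (NumberField.RingOfIntegers K), v ∉ S → (∃ α : Multiset ℂ, π.1.HasSatakeParamAt v α ∧ ∀ 𝔓 ∈ v.primesAbove, ∀ σ : Field.absoluteGaloisGroup K, IsArithFrobAt (NumberField.RingOfIntegers K) σ 𝔓 → ∀ i : ℕ, Valued.v ((Literature.NumberTheory.GaloisRepresentations.FramedRep.charpoly ρ σ - Literature.NumberTheory.Automorphic.arithFrobPolyOfSatake ι v.residueCard 1 α).coeff i) < r)) → ∃ π : Literature.NumberTheory.Automorphic.CuspidalAutomorphicRepData n K hcpt, π.1.IsLAlgebraic ∧ ∀ᶠ v : IsDedekindDomain.HeightOneSpectrum (NumberField.RingOfIntegers K) in cofinite, SatakeFrobCompatibleAt ι π.1 ρ v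

/-- item stmt-Langlands-17415 · crux · rank 6 · open · by planner
why it might fail: no construction of ρ for irregular L-algebraic π (Maass λ = ¼, non-cohomological weights) or for K neither totally real nor CM; irreducibility open for n ≥ 3 outside polarized / density-one cases.
sources: BuzzardGeeLMS2014, HarrisLanTaylorThorneRMS2016, Scholze2015
[crux] W⁺ — for every number field K, n ≥ 1, every L-algebraic cuspidal π of GL_n(𝔸_K) and every (ℓ,
ι) there is an IRREDUCIBLE ρ : Γ_K → GL_n(ℚ̄_ℓ) Satake–Frobenius compatible with (π, ι) at almost
all places (Buzzard–Gee Conj. 3.2.2 weak form + Ramakrishnan's cuspidal ⇒ irreducible; Clozel's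
Conj. 1.1.1 in arXiv:2607.11763). No de Rham clause, no Rec: ε-free and Rec-free. [difficulty:
open-problem] -/
@[route_item "route-Langlands-DepthPrimeSplit", crux]
def SatakeAvatarExistence : Prop :=
  ∀ (K : Type) [Field K] [NumberField K] (n : ℕ) (hcpt : Literature.NumberTheory.Automorphic.isCompact_glFiniteIntegralLevel n K), 0 < n → ∀ (π : Literature.NumberTheory.Automorphic.CuspidalAutomorphicRepData n K hcpt), π.1.IsLAlgebraic → ∀ (ℓ : ℕ) [Fact ℓ.Prime] (ι : PadicAlgCl ℓ ≃+* ℂ), ∃ ρ : Literature.NumberTheory.GaloisRepresentations.FramedGaloisRep K (PadicAlgCl ℓ) n, ρ.toGaloisRep.IsIrreducible ∧ ∀ᶠ v : IsDedekindDomain.HeightOneSpectrum (NumberField.RingOfIntegers K) in cofinite, SatakeFrobCompatibleAt ι π.1 ρ v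

/-- item stmt-Langlands-17534 · crux · rank 7 · open · by planner
why it might fail: local–global compatibility at p for non-polarizable regular π over CM fields is known only up to semisimplification/ under genericity (A'Campo 2024, Hevesi), and is completely open for irregular π.
sources: Caraiani2014, BarnetLambGeeGeraghtyTaylor2014, BuzzardGeeLMS2014
[crux] P — the PRIME-SWITCH PRINCIPLE for the p-adic member of the automorphic compatible system
(Rec-parametric, Rec-free in content; rev 1, cone repair: stated over the summit's own predicates
only): for π L-algebraic cuspidal on GL_n/K, ρ an irreducible ℓ-adic avatar of (π, ι)
(Satake–Frobenius compatible a.e.) and a place v ∣ ℓ: (i) ρ|_v is de Rham for Fontaine's pinned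
datum; (ii) for EVERY reciprocity datum Rec, every prime ℓ' ∤ v, ι' and every irreducible ℓ'-adic
avatar ρ' of (π, ι'), local–global compatibility of (π, ρ') at v for Rec (read ℓ'-adically,
Grothendieck–Deligne) implies local–global compatibility of (π, ρ) at v for Rec (read through
D_pst). Mathematically (ii) is Fontaine's C_WD for the system {ρ_(π,ι)}: the
Frobenius-semisimplified Weil–Deligne representation at v of the p-adic member, computed by D_pst,
is the common one of the ℓ'-adic members (Saito arXiv:math/0612077 for Hilbert modular forms;
Caraiani 2012/2014 for Shimura varieties; AHTW 2026 Thm 1.2.1 up to semisimplification for regular π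
over CM). Kernel-certified consequence of `Langlands` (bc/SubsOfLanglands.lean); with L∤ at (π, ι',
ρ') it is Taylor's Conj. 7 at v ∣ ℓ — the glue's patching lemma. -/
@[route_item "route-Langlands-DepthPrimeSplit", crux]
def PadicMemberCompatibility : Prop :=
  ∀ (K : Type) [Field K] [NumberField K] (n : ℕ) (hcpt : Literature.NumberTheory.Automorphic.isCompact_glFiniteIntegralLevel n K), 0 < n → ∀ (π : Literature.NumberTheory.Automorphic.CuspidalAutomorphicRepData n K hcpt), π.1.IsLAlgebraic → ∀ (ℓ : ℕ) [Fact ℓ.Prime] (ι : PadicAlgCl ℓ ≃+* ℂ) (ρ : Literature.NumberTheory.GaloisRepresentations.FramedGaloisRep K (PadicAlgCl ℓ) n), ρ.toGaloisRep.IsIrreducible → (∀ᶠ v : IsDedekindDomain.HeightOneSpectrum (NumberField.RingOfIntegers K) in cofinite, SatakeFrobCompatibleAt ι π.1 ρ v) → ∀ (v : IsDedekindDomain.HeightOneSpectrum (NumberField.RingOfIntegers K)) (hv : ((ℓ : ℕ) : NumberField.RingOfIntegers K) ∈ v.asIdeal), (Literature.NumberTheory.PAdicHodge.fontainePstAdicCompletion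 v ℓ hv).IsDeRhamFramed (ρ.toLocal v) ∧ ∀ (Rec : ReciprocityData K) (ℓ' : ℕ) [Fact ℓ'.Prime] (ι' : PadicAlgCl ℓ' ≃+* ℂ) (ρ' : Literature.NumberTheory.GaloisRepresentations.FramedGaloisRep K (PadicAlgCl ℓ') n), ((ℓ' : ℕ) : NumberField.RingOfIntegers K) ∉ v.asIdeal → ρ'.toGaloisRep.IsIrreducible → (∀ᶠ w : IsDedekindDomain.HeightOneSpectrum (NumberField.RingOfIntegers K) in cofinite, SatakeFrobCompatibleAt ι' π.1 ρ' w) → LocalGlobalCompatibleAt Rec ι' π.1 ρ' v → LocalGlobalCompatibleAt Rec ι π.1 ρ v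

/-- item stmt-Langlands-18084 · crux · rank 8 · open · by planner
why it might fail: for non-polarizable π over CM fields compatibility at v ∤ ℓ is known only up to Frobenius-semisimplification and monodromy (Varma), and nothing is known off the regular totally-real/CM sector.
sources: Varma2024, TaylorYoshida2007, BuzzardGeeLMS2014
[crux] L∤R — Taylor 2004 Conj. 7 at the places v ∤ ℓ, in the `∀ Rec` form (rev 4, lockstep re-type
after the summit re-type p141787 `∀ F, Nonempty (ReciprocityData F) ∧ ∀ 𝓡 …`): for every number
field K and EVERY reciprocity datum Rec (Henniart-normalised local Langlands data with THE canonical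
Artin pins — the summit's `∀ 𝓡`), every n ≥ 1 and hcpt, every L-algebraic cuspidal π of GL_n(𝔸_K),
every (ℓ, ι) and every IRREDUCIBLE ρ : Γ_K → GL_n(ℚ̄_ℓ) that is pinned-geometric (unramified a.e.,
de Rham above ℓ for Fontaine's pinned datum) and Satake–Frobenius compatible with (π, ι) a.e.:
`LocalGlobalCompatibleAt Rec ι π ρ v` at every finite v ∤ ℓ (Grothendieck–Deligne Weil–Deligne
representation, Frobenius-semisimplified, ↔ rec_v(π_v)). = item L∤ (stmt-Langlands-17417, ∃-Rec
form; verbatim the registered stub `stub_pairCompatibilityAway` of line `Sketch` of crux 14328) with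
Rec moved from `∃ Rec,` to a universal binder after K and nothing else changed; the ∃-form is
implied back by L∤R ∧ CanonicalReciprocityData (`compatibilityAwayFromL_existsForm`).
Kernel-certified consequence of the re-typed summit (`compatibilityAwayFromLR_of_langlands`, planner
bc/SubsOfLanglandsR.lean: direction (A -/
@[route_item "route-Langlands-DepthPrimeSplit", crux]
def CompatibilityAwayFromLR : Prop :=
  ∀ (K : Type) [Field K] [NumberField K] (Rec : ReciprocityData K) (n : ℕ) (hcpt : Literature.NumberTheory.Automorphic.isCompact_glFiniteIntegralLevel n K), 0 < n → ∀ (π : Literature.NumberTheory.Automorphic.CuspidalAutomorphicRepData n K hcpt), π.1.IsLAlgebraic → ∀ (ℓ : ℕ) [Fact ℓ.Prime] (ι : PadicAlgCl ℓ ≃+* ℂ) (ρ : Literature.NumberTheory.GaloisRepresentations.FramedGaloisRep K (PadicAlgCl ℓ) n), ρ.toGaloisRep.IsIrreducible → ((∀ᶠ v : IsDedekindDomain.HeightOneSpectrum (NumberField.RingOfIntegers K) in cofinite, ρ.IsUnramifiedAt v) ∧ ∀ (v : IsDedekindDomain.HeightOneSpectrum (NumberField.RingOfIntegers K)) (hv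 : ((ℓ : ℕ) : NumberField.RingOfIntegers K) ∈ v.asIdeal), (Literature.NumberTheory.PAdicHodge.fontainePstAdicCompletion v ℓ hv).IsDeRhamFramed (ρ.toLocal v)) → (∀ᶠ v : IsDedekindDomain.HeightOneSpectrum (NumberField.RingOfIntegers K) in cofinite, SatakeFrobCompatibleAt ι π.1 ρ v) → ∀ v : IsDedekindDomain.HeightOneSpectrum (NumberField.RingOfIntegers K), ((ℓ : ℕ) : NumberField.RingOfIntegers K) ∉ v.asIdeal → LocalGlobalCompatibleAt Rec ι π.1 ρ v

/-- item stmt-Langlands-17930 · support · rank 9 · open · by planner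
sources: HarrisTaylor2001, Henniart2000, BuzzardGeeLMS2014
[support] THE SUMMIT'S NON-VACUITY CONJUNCT, verbatim (statement revision p141787, 2026-08-17:
`Langlands := ∀ F, Nonempty (ReciprocityData F) ∧ ∀ 𝓡 n, 0 < n → ∀ hcpt, GLC n F 𝓡 hcpt`, with
`ReciprocityData` pinned to THE local Artin maps by `llc_isCanonical` / `llc_eps_isCanonical`),
filed by route-repair 5a1bd9af as the explicit INPUT of this route's `∃ RD`-shaped slices
(LiftB2Unram, LiftB2UnramSmallF, LiftB2UnramLargeF, LiftB2UnramSplitP): for every number field F and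
every finite place v, a local Langlands datum for GL_n(F_v) (Harris–Taylor 2001 Thm A; Henniart 2000
Thm 1.2) normalised against THE local Artin map `canonicalArtin (F_v)`, whose ε-system (Deligne 1973
Thm 4.1) is normalised against the canonical Artin map of every finite E/F_v. IN PRINT,
textbook-grade input (Harris–Taylor's Thm A is stated relative to Art_K of local class field
theory); in the TREE not yet derivable — `LocalLanglandsDatum.nonempty` (cite-only) yields a datum
with SOME lawful Artin normalisation, and canonicity needs `IsLocalArtinMap.unique` + the
finite-level reciprocity law for that datum's Artin maps, or canonical variants of
`localLanglands_gl` / `nonempty_localEpsilonSystem` (needs-fact for -/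
@[route_item "route-Langlands-DepthPrimeSplit", crux]
def CanonicalReciprocityData : Prop :=
  ∀ (F : Type) [Field F] [NumberField F], Nonempty (Summit.Langlands.ReciprocityData F)

/-- item stmt-Langlands-25027 · aside · rank 9 · open · by planner
sources: KhareWintenberger2009, Kisin2009TwoAdic, Katz1977, DeligneSerreASENS1974
[support] DyadicSeed for K = ℚ, n = 2 (BC5 rung and first stub of DyadicSeed's skeleton): every
irreducible pinned-geometric ρ : Γ_ℚ → GL₂(ℚ̄₂), EVEN ones included, is residually automorphic mod 2
— closed-mod-print: Khare–Wintenberger Thm 9.1 at p = 2 with Kisin (H) for residually irreducible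
classes (tree fact `SerreConjecture.SerreModularityConjecture 2 k` + the newform → L-algebraic π
dictionary of item `PhantomRMYoshida.SerreKWAutomorphicGL2`), Eisenstein-to-cusp congruences mod 2
for split classes (Δ ⊗ [χ]; Katz θ + Deligne–Serre 6.11). ASIDE in this route (banked BC5 rung =
first stub of DyadicSeed's skeleton; not a binder of `closes`, never staffed from here).
[difficulty: L] -/
@[route_item "route-Langlands-DepthPrimeSplit"]
def DyadicSeedRankTwoQ : Prop :=
  ∀ (hcpt : Literature.NumberTheory.Automorphic.isCompact_glFiniteIntegralLevel 2 ℚ) (ι : PadicAlgCl 2 ≃+* ℂ) (ρ : Literature.NumberTheory.GaloisRepresentations.FramedGaloisRep ℚ (PadicAlgCl 2) 2), ρ.toGaloisRep.IsIrreducible → ((∀ᶠ v : IsDedekindDomain.HeightOneSpectrum (NumberField.RingOfIntegers ℚ) in cofinite, ρ.IsUnramifiedAt v) ∧ ∀ (v : IsDedekindDomain.HeightOneSpectrum (NumberField.RingOfIntegers ℚ)) (hv : ((2 : ℕ) : NumberField.RingOfIntegers ℚ) ∈ v.asIdeal), (Literature.NumberTheory.PAdicHodge.fontainePstAdicCompletion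 v 2 hv).IsDeRhamFramed (ρ.toLocal v)) → ∃ π : Literature.NumberTheory.Automorphic.CuspidalAutomorphicRepData 2 ℚ hcpt, π.1.IsLAlgebraic ∧ ∀ᶠ v : IsDedekindDomain.HeightOneSpectrum (NumberField.RingOfIntegers ℚ) in cofinite, (∃ α : Multiset ℂ, π.1.HasSatakeParamAt v α ∧ ∀ 𝔓 ∈ v.primesAbove, ∀ σ : Field.absoluteGaloisGroup ℚ, IsArithFrobAt (NumberField.RingOfIntegers ℚ) σ 𝔓 → ∀ i : ℕ, Valued.v ((Literature.NumberTheory.GaloisRepresentations.FramedRep.charpoly ρ σ - Literature.NumberTheory.Automorphic.arithFrobPolyOfSatake ι v.residueCard 1 α).coeff i) < 1)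

/-- item stmt-Langlands-25028 · assembly · rank 1 · closed · proved by Summit.Langlands.Langlands.Theorems.depthPrimeSplit_assembly_proof (prover) · by planner
sources: Emerton2011LocalGlobal, KhareWintenberger2009, BuzzardGeeLMS2014
[assembly] DyadicSeed → OddPrimeSeed → FernSpread → Classicality → SatakeAvatarExistence →
PadicMemberCompatibility → CompatibilityAwayFromLR → CanonicalReciprocityData → Langlands. -/
@[route_item "route-Langlands-DepthPrimeSplit"]
def Assembly : Prop :=
  DyadicSeed → OddPrimeSeed → FernSpread → Classicality → SatakeAvatarExistence → PadicMemberCompatibility → CompatibilityAwayFromLR → CanonicalReciprocityData → _root_.Langlands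

-- `Assembly` holds: proved by `Summit.Langlands.Langlands.Theorems.depthPrimeSplit_assembly_proof` (its module imports this route file, so no `_holds` link can be stated here).

/-! D-0027 §2.1 — DECIDING THEOREM (planner-authored via `route open/edit --closes-file`; by planner-decomp-langlands-writer-1-g0-0 2026-08-30T02:13:52Z):
its hypotheses are this route's items and its conclusion the sub-problem Statement (glue_lint), and it elaborates with this file. -/

/- (spliced by the gate into the rendered route file via `--closes-file`; not a standalone module — certified by
   `ledger route check --native route.json --closes-file glue.lean`: verdict OK)
   D-0027 §2.1 deciding theorem for route DepthPrimeSplit (decomp-langlands lens-4 gen 0, v2.1; filed by writer-1 gen 0).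
   Self-contained over the INLINED one-liner items: seam DyadicSeed/OddPrimeSeed → FernSpread → Classicality gives B_w at the prime in hand,
   then N0's level-1 glue verbatim (prime switch ℓ' ∈ {2,3}, member transport through P, L∤R away from ℓ, U = landed theorem). -/
@[closes "route-Langlands-DepthPrimeSplit"] theorem closes (hD : DyadicSeed) (hO : OddPrimeSeed) (hF : FernSpread) (hC : Classicality)
    (hW : SatakeAvatarExistence) (hP : PadicMemberCompatibility) (hA : CompatibilityAwayFromLR)
    (hR : CanonicalReciprocityData) : _root_.Langlands := by
  -- `Assembly` (item) is literally the curried form of this theorem: prove it, then apply it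
  -- (pulls the Assembly item into the cone of `closes`; writer convention of the sibling routes).
  suffices hAsm : Assembly from hAsm hD hO hF hC hW hP hA hR
  clear hD hO hF hC hW hP hA hR
  intro hD hO hF hC hW hP hA hR
  -- U = N0 item stmt-Langlands-17844, PROVED in the tree: consumed as the landed theorem, not re-filed as an item.
  have hU := @_root_.Summit.Langlands.Langlands.Theorems.EisensteinDegreeShiftSectorComplement.stub_avatarConjugacy
  intro F _ _
  refine ⟨hR F, fun Rec n hn hcpt => ?_⟩
  have hRec := hA F Rec
  -- every finite place misses the prime 2 or the prime 3
  have hprime : ∀ v : IsDedekindDomain.HeightOneSpectrum (NumberField.RingOfIntegers F),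
      ∃ (ℓ' : ℕ) (_ : Fact ℓ'.Prime), ((ℓ' : ℕ) : NumberField.RingOfIntegers F) ∉ v.asIdeal := by
    intro v
    by_cases h2 : ((2 : ℕ) : NumberField.RingOfIntegers F) ∈ v.asIdeal
    · refine ⟨3, ⟨Nat.prime_three⟩, fun h3 => v.isPrime.ne_top ((Ideal.eq_top_iff_one _).2 ?_)⟩
      have h := v.asIdeal.sub_mem h3 h2
      have h1 : ((3 : ℕ) : NumberField.RingOfIntegers F) - ((2 : ℕ) : NumberField.RingOfIntegers F) = 1 := by
        push_cast; norm_num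
      rwa [h1] at h
    · exact ⟨2, ⟨Nat.prime_two⟩, h2⟩
  -- the local–global helper of N0: geometric + compatible at EVERY finite place
  have hLGC : ∀ (π : Literature.NumberTheory.Automorphic.CuspidalAutomorphicRepData n F hcpt), π.1.IsLAlgebraic →
      ∀ (ℓ : ℕ) [Fact ℓ.Prime] (ι : PadicAlgCl ℓ ≃+* ℂ)
        (ρ : Literature.NumberTheory.GaloisRepresentations.FramedGaloisRep F (PadicAlgCl ℓ) n),
        ρ.toGaloisRep.IsIrreducible →
        (∀ᶠ v : IsDedekindDomain.HeightOneSpectrum (NumberField.RingOfIntegers F) in cofinite,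
          SatakeFrobCompatibleAt ι π.1 ρ v) →
        IsGeometricFramed Rec ρ ∧
          ∀ v : IsDedekindDomain.HeightOneSpectrum (NumberField.RingOfIntegers F),
            LocalGlobalCompatibleAt Rec ι π.1 ρ v := by
    intro π hL ℓ _ ι ρ hirr hρ
    have hgeo : (∀ᶠ v : IsDedekindDomain.HeightOneSpectrum (NumberField.RingOfIntegers F) in cofinite,
        ρ.IsUnramifiedAt v) ∧
        ∀ (v : IsDedekindDomain.HeightOneSpectrum (NumberField.RingOfIntegers F))
          (hv : ((ℓ : ℕ) : NumberField.RingOfIntegers F) ∈ v.asIdeal),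
          (Literature.NumberTheory.PAdicHodge.fontainePstAdicCompletion v ℓ hv).IsDeRhamFramed
            (ρ.toLocal v) :=
      ⟨hρ.mono fun v ⟨_, _, hur, _⟩ => hur, fun v hv => (hP F n hcpt hn π hL ℓ ι ρ hirr hρ v hv).1⟩
    refine ⟨hgeo, fun v => ?_⟩
    by_cases hv : ((ℓ : ℕ) : NumberField.RingOfIntegers F) ∈ v.asIdeal
    · obtain ⟨ℓ', _, hℓ'⟩ := hprime v
      obtain ⟨ι'⟩ := PadicAlgCl.nonempty_ringEquiv_complex ℓ'
      obtain ⟨ρ', hirr', hρ'⟩ := hW F n hcpt hn π hL ℓ' ι'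
      have hgeo' : (∀ᶠ w : IsDedekindDomain.HeightOneSpectrum (NumberField.RingOfIntegers F) in cofinite,
          ρ'.IsUnramifiedAt w) ∧
          ∀ (w : IsDedekindDomain.HeightOneSpectrum (NumberField.RingOfIntegers F))
            (hw : ((ℓ' : ℕ) : NumberField.RingOfIntegers F) ∈ w.asIdeal),
            (Literature.NumberTheory.PAdicHodge.fontainePstAdicCompletion w ℓ' hw).IsDeRhamFramed
              (ρ'.toLocal w) :=
        ⟨hρ'.mono fun w ⟨_, _, hur, _⟩ => hur,
          fun w hw => (hP F n hcpt hn π hL ℓ' ι' ρ' hirr' hρ' w hw).1⟩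
      exact (hP F n hcpt hn π hL ℓ ι ρ hirr hρ v hv).2 Rec ℓ' ι' ρ' hℓ' hirr' hρ'
        (hRec n hcpt hn π hL ℓ' ι' ρ' hirr' hgeo' hρ' v hℓ')
    · exact hRec n hcpt hn π hL ℓ ι ρ hirr hgeo hρ v hv
  refine ⟨?_, ?_⟩
  · -- (A) automorphic → Galois, with uniqueness up to conjugacy from the support item
    intro π hL ℓ _ ι
    obtain ⟨ρ, hirr, hρ⟩ := hW F n hcpt hn π hL ℓ ι
    obtain ⟨hgeo, hloc⟩ := hLGC π hL ℓ ι ρ hirr hρ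
    exact ⟨ρ, hirr, hgeo, ⟨hρ, hloc⟩, fun ρ' h' => hU F n hcpt π ℓ ι ρ ρ' hirr hρ h'.1⟩
  · -- (B) Galois → automorphic: residual automorphy at the prime in hand (ℓ = 2 / odd), fern spread to every
    -- ℓ-adic depth, classicality of the pro-automorphic de Rham point; then N0's local–global helper.
    intro ℓ _ ι ρ hirr hgeo
    have hres : ∃ π : Literature.NumberTheory.Automorphic.CuspidalAutomorphicRepData n F hcpt, π.1.IsLAlgebraic ∧
        ∀ᶠ v : IsDedekindDomain.HeightOneSpectrum (NumberField.RingOfIntegers F) in cofinite,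
          ∃ α : Multiset ℂ, π.1.HasSatakeParamAt v α ∧ ∀ 𝔓 ∈ v.primesAbove, ∀ σ : Field.absoluteGaloisGroup F,
            IsArithFrobAt (NumberField.RingOfIntegers F) σ 𝔓 → ∀ i : ℕ,
              Valued.v ((Literature.NumberTheory.GaloisRepresentations.FramedRep.charpoly ρ σ -
                Literature.NumberTheory.Automorphic.arithFrobPolyOfSatake ι v.residueCard 1 α).coeff i) < 1 := by
      by_cases h2 : ℓ = 2
      · subst h2
        exact hD F n hcpt hn ι ρ hirr hgeo
      · exact hO F n hcpt hn ℓ h2 ι ρ hirr hgeo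
    obtain ⟨π₁, hL₁, hρ₁⟩ := hC F n hcpt hn ℓ ι ρ hirr hgeo (hF F n hcpt hn ℓ ι ρ hirr hgeo hres)
    exact ⟨π₁, hL₁, hρ₁, (hLGC π₁ hL₁ ℓ ι ρ hirr hρ₁).2⟩

end Summit.Langlands.Langlands.Theses.DepthPrimeSplit
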